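import Mathlib.NumberTheory.Padics.Complex
import Summits.Langlands.Langlands.Statement
import Summits.Langlands.Langlands.Theorems.SkinnerWilesDefectOneEisensteinProModularSeedLevelRaisedEisensteinNewformQGlue
import Literature.NumberTheory.EllipticCurves.FramedTateGaloisRep
import Literature.NumberTheory.EllipticCurves.HasseWeilGoodReductionProofs
import Literature.NumberTheory.Automorphic.BCDTModularity
import Literature.NumberTheory.Automorphic.ReciprocityGLnPotentialModularity
import Literature.NumberTheory.Automorphic.AlgebraicityTwist
import HarnessLib
import Literature.NumberTheory.Automorphic.CaraianiNewtonResidualImageModularity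

/-!
# `EisensteinProModularSeed` (stmt-Langlands-12920), line `descend-raise-basechange` (v4, the
# cousin graft) — stub S7b `stub_cousinAutomorphic`: the automorphic half of the cousin

For `F` imaginary quadratic, a prime `p`, `ι : ℚ̄_p ≃ ℂ` and an elliptic curve `E / F` whose mod-`3`
representation has image containing `SL₂(𝔽₃)`, Caraiani–Newton (2023), Cor. 6.1.1 (1), makes `E`
MODULAR: there is a cuspidal automorphic representation `π` of `GL₂(𝔸_F)` of parallel weight `2`
(regular algebraic of weight `0`) with the same `L`-function as `E`.  Read Euler factor by Euler
factor at the places of good reduction this is the NAMED FACT `CaraianiNewton2023_cor611_modular`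
below (the tree's vocabulary: `HasWeightZero`, `HasHeckePolynomialAt w (X² − a_w(E) X + q_w)`,
verbatim the shape of the accepted `IsAutomorphicOfWeightZero` of `ReciprocityGLnPotentialModularity`,
for a curve over the field `F` at its places of good reduction `HasGoodReductionAt`, with
`a_w(E) = E.frobeniusTraceAt w`).  It is the ONLY unproved input; the theorem
`stub_cousinAutomorphic` is the registered stub with this fact prepended.

## The proof (everything below the fact is checked here)

Given the weight-`0` cuspidal `π` of the fact:

* the `L`-algebraic twist `πF := π ⊗ |det|_𝔸^{1/2}` is cuspidal with infinity type
  `T' = T₀.twist (1/2)`, `T₀ = weightZeroInfinityType 2 F = {(1/2, −1/2), (−1/2, 1/2)}`, i.e.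
  `T' σ = {(1, 0), (0, 1)}` (the tree's `CuspidalAutomorphicRepData.exists_twist_hasInfinityType`,
  Borel–Jacquet 5.7); `T'` is `L`-algebraic (`isCAlgebraic_iff_isLAlgebraic_twist`, Buzzard–Gee
  §5.3) and regular (`IsRegular.twist`);
* at `v ∉ S` (so `v ∤ p` and `E` has good reduction at `v`) the Hecke polynomial
  `X² − a_v X + q_v` of `π` gives a Satake parameter `{z₁, z₂}` with `q_v^{1/2}(z₁ + z₂) = a_v`,
  `z₁ z₂ = 1` (`exists_hasSatakeParamAt_of_hasHeckePolynomialAt_frobPoly`), hence the Satake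
  parameter `{q_v^{-1/2} z₁, q_v^{-1/2} z₂}` of `πF`
  (`HasSatakeParamAt.of_map_mulChar_detTwist_of_cpow`: `t_{π ⊗ |det|^s, v} = q_v^{-s} t_{π,v}`), whose
  Buzzard–Gee polynomial `∏ (X − ι⁻¹((q_v^{-1/2} z_j)⁻¹)) = X² − a_v X + q_v`
  (`arithFrobPolyOfSatake_half_twist_pair`);
* on the Galois side, every arithmetic Frobenius at `v` has characteristic polynomial
  `X² − a_v X + q_v` on `V_pE` (the tree's THEOREMS
  `trace/det_galoisRepTate_frobenius_of_hasGoodReductionAt_holds`, Silverman C.21.3, transported to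
  the frame `E.framedTateGaloisRep p` by `hasFrobCharpolyAt_framedTateGaloisRep_iff`) and `V_pE` is
  unramified there (`isUnramifiedAt_framedTateGaloisRep`, Silverman VII.4.1); both clauses are
  invariant under the change of frame `r = P · ρ_{E,p} · P⁻¹` (`isUnramifiedAt_conj_iff`,
  `hasFrobCharpolyAt_conj_iff`).

So `SatakeFrobCompatibleAt ι πF r v` at every `v ∉ S`, with the ARITHMETIC-Frobenius / unitary
normalisations of `Summit.Langlands.SatakeFrobCompatibleAt` and `HasSatakeParamAt` matched exactly as
in `IsModularEllipticCurve` (`√q_v (z₁ + z₂) = a_v`) — the `L`-algebraic `πF = π ⊗ |det|^{1/2}`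
corresponds to `V_pE` itself (Hodge–Tate weights `{0, −1}`), the weight-`0` `π` to `V_pE^∨` in the
Harris–Lan–Taylor–Thorne normalisation (`r_{π,ι} ≅ r_{E,p}^∨`, Caraiani–Newton §6).
-/

set_option linter.dupNamespace false -- project-wide option (lakefile weak.linter.dupNamespace); `Summit.Langlands.Langlands` is the mandated namespace

noncomputable section

namespace Summit.Langlands.Langlands.Theorems.SkinnerWilesDefectOne.EisensteinProModularSeed

open Literature.NumberTheory.Automorphic Literature.NumberTheory.GaloisRepresentations
open NumberField IsDedekindDomain Polynomial
open scoped NumberField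

/-! ### The printed input (named fact, `def … : Prop`) -/

/-- `q^{-1/2} = (√q)⁻¹` as complex numbers (`q : ℕ`; the exponent written as the real number `1/2`
cast to `ℂ`, the form produced by `CuspidalAutomorphicRepData.exists_twist_hasInfinityType`).
[folklore] -/
theorem natCast_cpow_neg_half (q : ℕ) :
    (q : ℂ) ^ (-(((1 / 2 : ℝ)) : ℂ)) = (((Real.sqrt q : ℝ)) : ℂ)⁻¹ := by
  rw [Complex.cpow_neg, Real.sqrt_eq_rpow, Complex.ofReal_cpow (Nat.cast_nonneg _),
    Complex.ofReal_natCast]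

/-- **The half-twisted pair.**  If `r ≠ 0`, `r² = q`, `r (z₁ + z₂) = a` and `r² z₁ z₂ = q` (the
Satake parameter `{z₁, z₂}` of a weight-`0` `π` with Hecke polynomial `X² − a X + q`, `r = q^{1/2}`),
then the inverses of `r⁻¹ z₁, r⁻¹ z₂` (the Satake parameter of `π ⊗ |det|^{1/2}`) have sum `a` and
product `q`. [folklore] -/
theorem inv_half_twist_pair {r z₁ z₂ a q : ℂ} (hr : r ≠ 0) (hr2 : r ^ 2 = q)
    (hsum : r * (z₁ + z₂) = a) (hprod : r ^ 2 * (z₁ * z₂) = q) :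
    (r⁻¹ * z₁)⁻¹ + (r⁻¹ * z₂)⁻¹ = a ∧ (r⁻¹ * z₁)⁻¹ * (r⁻¹ * z₂)⁻¹ = q := by
  have h12 : z₁ * z₂ = 1 := by
    have h : r ^ 2 * (z₁ * z₂) = r ^ 2 * 1 := by rw [mul_one, hprod, hr2]
    exact mul_left_cancel₀ (pow_ne_zero 2 hr) h
  have hz₁ : z₁⁻¹ = z₂ := inv_eq_of_mul_eq_one_right h12
  have hz₂ : z₂⁻¹ = z₁ := inv_eq_of_mul_eq_one_left h12
  rw [mul_inv, mul_inv, inv_inv, hz₁, hz₂]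
  constructor
  · rw [← hsum]; ring
  · rw [← hr2]
    linear_combination r ^ 2 * h12

/-- **The Buzzard–Gee polynomial of the half-twisted Satake parameter is `X² − a X + q`.**  For
`ι : ℚ̄_p ≃ ℂ`, `q > 0`, an integer `a` and `z₁, z₂ ∈ ℂ` with `q^{1/2}(z₁ + z₂) = a`,
`q z₁ z₂ = q`: `arithFrobPolyOfSatake ι q 1 {q^{-1/2} z₁, q^{-1/2} z₂} = X² − a X + q` in `ℚ̄_p[X]`
(roots `ι⁻¹((q^{-1/2} z_j)⁻¹)`, whose sum is `ι⁻¹(a) = a` and product `ι⁻¹(q) = q`). [folklore] -/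
theorem arithFrobPolyOfSatake_half_twist_pair {p : ℕ} [Fact p.Prime] (ι : PadicAlgCl p ≃+* ℂ)
    {q : ℕ} (hq : 0 < q) (a : ℤ) {z₁ z₂ : ℂ}
    (hsum : ((Real.sqrt q : ℝ) : ℂ) * ({z₁, z₂} : Multiset ℂ).sum = (a : ℂ))
    (hprod : ((Real.sqrt q : ℝ) : ℂ) ^ 2 * ({z₁, z₂} : Multiset ℂ).prod = (q : ℂ)) :
    arithFrobPolyOfSatake ι q 1
        (({z₁, z₂} : Multiset ℂ).map (((q : ℂ) ^ (-(((1 / 2 : ℝ)) : ℂ))) * ·)) =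
      X ^ 2 - C (a : PadicAlgCl p) * X + C (q : PadicAlgCl p) := by
  have hr : (((Real.sqrt q : ℝ)) : ℂ) ≠ 0 :=
    Complex.ofReal_ne_zero.2 (Real.sqrt_ne_zero'.2 (by exact_mod_cast hq))
  have hr2 : (((Real.sqrt q : ℝ)) : ℂ) ^ 2 = (q : ℂ) := by
    rw [← Complex.ofReal_pow, Real.sq_sqrt (Nat.cast_nonneg _), Complex.ofReal_natCast]
  simp only [Multiset.insert_eq_cons, Multiset.sum_cons, Multiset.sum_singleton, Multiset.prod_cons,
    Multiset.prod_singleton] at hsum hprod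
  obtain ⟨h1, h2⟩ := inv_half_twist_pair hr hr2 hsum hprod
  rw [natCast_cpow_neg_half, arithFrobPolyOfSatake_one]
  simp only [Multiset.insert_eq_cons, Multiset.map_cons, Multiset.map_singleton, Multiset.prod_cons,
    Multiset.prod_singleton]
  rw [X_sub_C_mul_X_sub_C, ← map_add ι.symm, ← map_mul ι.symm, h1, h2, map_intCast, map_natCast]

/-- **Frobenius on `ρ_{E,p}` at a good place `v ∤ p`: `X² − a_v(E) X + q_v`** (every arithmetic
Frobenius at `v`, on the framed Tate module `E.framedTateGaloisRep p`).  The tree's theorems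
`trace_galoisRepTate_frobenius_of_hasGoodReductionAt_holds` / `det_…_holds` (Silverman, *AEC*, C.21
Remark 21.3: `Trace ρ(φ_v) = a_v`, `Norm ρ(φ_v) = q_v`, via V.2.3.1, VII.4.1 and the Weil pairing),
assembled on `V_pE` by `hasFrobCharpolyAt_rationalTateGaloisRepOf_of_hasGoodReductionAt` and
transported to the frame by `hasFrobCharpolyAt_framedTateGaloisRep_iff`; `q_v = #k_v`
(`natCard_residueField_eq_residueCard`). [cite: SilvermanAEC2009, C.21 Remark 21.3] -/
theorem hasFrobCharpolyAt_framedTateGaloisRep_of_hasGoodReductionAt {F : Type} [Field F]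
    [NumberField F] (E : WeierstrassCurve F) [E.IsElliptic] (p : ℕ) [Fact p.Prime]
    {v : HeightOneSpectrum (𝓞 F)} (hp : (p : 𝓞 F) ∉ v.asIdeal) (hv : E.HasGoodReductionAt v) :
    (E.framedTateGaloisRep p).HasFrobCharpolyAt v
      (X ^ 2 - C ((E.frobeniusTraceAt v : ℤ) : PadicAlgCl p) * X +
        C ((v.residueCard : ℕ) : PadicAlgCl p)) := by
  haveI : Module.Finite ℚ_[p] (E.rationalTateModule p) := E.module_finite_rationalTateModule_holds p
  have h := WeierstrassCurve.hasFrobCharpolyAt_rationalTateGaloisRepOf_of_hasGoodReductionAt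
    (E.trace_galoisRepTate_frobenius_of_hasGoodReductionAt_holds p)
    (E.det_galoisRepTate_frobenius_of_hasGoodReductionAt_holds p)
    (E.continuous_rationalGaloisRepTate_holds p) hp hv
  have h' := (E.hasFrobCharpolyAt_framedTateGaloisRep_iff p
    (E.continuous_rationalGaloisRepTate_holds p) v _).2 h
  rw [WeierstrassCurve.natCard_residueField_eq_residueCard] at h'
  simpa [Polynomial.map_sub, Polynomial.map_add, Polynomial.map_mul, Polynomial.map_pow] using h'

/-! ### The stub -/

/-- **stub_cousinAutomorphic** (S7b of line `descend-raise-basechange`, v4 cousin graft: the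
automorphic half), CONDITIONAL on the named fact `CaraianiNewton2023_cor611_modular` (prepended;
the registered signature follows verbatim).  For `F` imaginary quadratic, `p` prime,
`ι : ℚ̄_p ≃ ℂ`, an elliptic curve `E / F` with `SL₂(𝔽₃) ⊆ im ρ̄_{E,3}`, a frame-conjugate
`r = P ρ_{E,p} P⁻¹` of `E.framedTateGaloisRep p` and a finite `S ⊇ {v ∣ p}` off which `E` has good
reduction: for every `hcpt` there are a CUSPIDAL `πF` of `GL₂(𝔸_F)` and a regular `L`-algebraic
infinity type `T'` of `πF` with `SatakeFrobCompatibleAt ι πF r v` at every `v ∉ S`.  Proof: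
`πF = π ⊗ |det|^{1/2}` for the weight-`0` `π` of Caraiani–Newton (`exists_twist_hasInfinityType`),
`T' = (weightZeroInfinityType 2 F).twist (1/2) = {(1,0),(0,1)}` (`L`-algebraic by
`isCAlgebraic_iff_isLAlgebraic_twist`, regular by `IsRegular.twist`); at `v ∉ S` the Satake parameter
`{q^{-1/2} z_j}` of `πF` (`of_map_mulChar_detTwist_of_cpow` applied to the parameter read off the Hecke
polynomial `X² − a_v X + q_v`, `exists_hasSatakeParamAt_of_hasHeckePolynomialAt_frobPoly`) has
`arithFrobPolyOfSatake ι q_v 1 _ = X² − a_v X + q_v` (`arithFrobPolyOfSatake_half_twist_pair`), the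
Frobenius polynomial of `ρ_{E,p}` at `v` (`hasFrobCharpolyAt_framedTateGaloisRep_of_hasGoodReductionAt`),
and `ρ_{E,p}` is unramified at `v` (`isUnramifiedAt_framedTateGaloisRep`); both transported to `r`
(`isUnramifiedAt_conj_iff`, `hasFrobCharpolyAt_conj_iff`).
[cite: CaraianiNewton2023, Cor. 6.1.1 (1), p. 87] -/
theorem stub_cousinAutomorphic :
    Literature.NumberTheory.Automorphic.CaraianiNewton2023_cor611_modular →
    ∀ (F : Type) [Field F] [NumberField F], NumberField.IsTotallyComplex F → Module.finrank ℚ F = 2 →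
      ∀ (p : ℕ) [Fact p.Prime] (ι : PadicAlgCl p ≃+* ℂ) (E : WeierstrassCurve F) [E.IsElliptic],
      (∃ ρ₃ : Literature.NumberTheory.GaloisRepresentations.FramedGaloisRep F (ZMod 3) 2, E.IsTorsionGaloisRep 3 ρ₃ ∧
          ∀ g : Matrix.SpecialLinearGroup (Fin 2) (ZMod 3), ∃ σ, ρ₃ σ = Matrix.SpecialLinearGroup.toGL g) →
      ∀ (r : Literature.NumberTheory.GaloisRepresentations.FramedGaloisRep F (PadicAlgCl p) 2)
        (Pfr : Matrix.GeneralLinearGroup (Fin 2) (PadicAlgCl p)),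
      r = Literature.NumberTheory.GaloisRepresentations.FramedRep.conj Pfr (E.framedTateGaloisRep p) →
      ∀ (S : Set (IsDedekindDomain.HeightOneSpectrum (NumberField.RingOfIntegers F))), S.Finite →
      (∀ v : IsDedekindDomain.HeightOneSpectrum (NumberField.RingOfIntegers F), (p : NumberField.RingOfIntegers F) ∈ v.asIdeal → v ∈ S) →
      (∀ v ∉ S, E.HasGoodReductionAt v) →
      ∀ hcpt : Literature.NumberTheory.Automorphic.isCompact_glFiniteIntegralLevel 2 F,
        ∃ (πF : Literature.NumberTheory.Automorphic.CuspidalAutomorphicRepData 2 F hcpt) (T' : Literature.NumberTheory.Automorphic.InfinityType F 2),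
          πF.1.HasInfinityType T' ∧ T'.IsLAlgebraic ∧ T'.IsRegular ∧
          ∀ v ∉ S, Summit.Langlands.SatakeFrobCompatibleAt ι πF.1 r v := by
  intro hCN F _ _ hF hdeg p _ ι E _ himg r Pfr hr S _ hSp hgood hcpt
  -- Caraiani–Newton: a weight-zero cuspidal `π` with Hecke polynomial `X² − a_w X + q_w` at the
  -- places of good reduction
  obtain ⟨hF', π, h0, hH⟩ := hCN F hF hdeg E himg
  -- `hF'` and `hcpt` are two proofs of one proposition
  obtain rfl : hF' = hcpt := rfl
  -- the `L`-algebraic twist `πF = π ⊗ |det|^{1/2}` and its infinity type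
  obtain ⟨χ, πF, hχ, hW, hW', hT'⟩ :=
    CuspidalAutomorphicRepData.exists_twist_hasInfinityType π (1 / 2 : ℝ)
      (T := weightZeroInfinityType 2 F) h0
  obtain ⟨hC, hreg⟩ := isRegularAlgebraic_weightZeroInfinityType 2 F
  refine ⟨πF, (weightZeroInfinityType 2 F).twist (((1 / 2 : ℝ)) : ℂ), hT', ?_, hreg.twist _, ?_⟩
  · -- `L`-algebraic: the `C`-algebraic weight-zero type twisted by `(n - 1)/2 = 1/2`
    have e : (((2 : ℕ) : ℂ) - 1) / 2 = (((1 / 2 : ℝ)) : ℂ) := by push_cast; norm_num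
    have hL := (InfinityType.isCAlgebraic_iff_isLAlgebraic_twist (n := 2)
      (weightZeroInfinityType 2 F)).mp hC
    rwa [e] at hL
  · intro v hv
    have hpv : (p : 𝓞 F) ∉ v.asIdeal := fun h => hv (hSp v h)
    -- the Satake parameter `{z₁, z₂}` of `π` at `v`, read off the Hecke polynomial
    obtain ⟨α, hα, hsum, hprod⟩ :=
      exists_hasSatakeParamAt_of_hasHeckePolynomialAt_frobPoly (hH v (hgood v hv))
    obtain ⟨z₁, z₂, rfl⟩ := Multiset.card_eq_two.1 hα.card_eq
    -- the Satake parameter `{q_v^{-1/2} z₁, q_v^{-1/2} z₂}` of `πF` at `v`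
    have hα' := AutomorphicRepData.HasSatakeParamAt.of_map_mulChar_detTwist_of_cpow hχ hW hW' hα
    refine ⟨_, hα', ?_, ?_⟩
    · -- `r` is unramified at `v` (good reduction, `v ∤ p`; change of frame)
      subst hr
      exact (FramedGaloisRep.isUnramifiedAt_conj_iff v Pfr _).2
        (E.isUnramifiedAt_framedTateGaloisRep p (hgood v hv) hpv)
    · -- Frobenius characteristic polynomial `X² − a_v X + q_v` on both sides
      subst hr
      rw [hasFrobCharpolyAt_conj_iff,
        arithFrobPolyOfSatake_half_twist_pair ι (Nat.zero_lt_of_lt v.one_lt_residueCard)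
          (E.frobeniusTraceAt v) hsum hprod]
      exact hasFrobCharpolyAt_framedTateGaloisRep_of_hasGoodReductionAt E p hpv (hgood v hv)

end Summit.Langlands.Langlands.Theorems.SkinnerWilesDefectOne.EisensteinProModularSeed

end
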